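import Literature.MathematicalPhysics.QuantumFieldTheory.Balaban1983to89.B9Eq326OperatorTower
import Literature.MathematicalPhysics.QuantumFieldTheory.Balaban1983to89.B9Eq333ProjectionCovariance
import Literature.MathematicalPhysics.QuantumFieldTheory.Balaban1983to89.B7AvgGaugeCovariance
import Literature.MathematicalPhysics.QuantumFieldTheory.Balaban1983to89.B7Eq44TorusAxialGauge

/-!
# `Balaban1983to89.B9Eq332QprimeTowerGaugeCovariance` — T. Bałaban, *Propagators for lattice gauge theories in a background field*, Commun. Math. Phys.
# **99** (1985) 389–434 [Balaban1985BackgroundPropagators] (3.32) p. 395 with (3.15) ∕ (3.19) p. 393, and [Balaban1985Averaging] (11) p. 19, p. 24: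
# **THE COMPOSITE SITE AVERAGING `Q′_k(U) = Q′(Ū^{k−1})⋯Q′(U)` IS GAUGE COVARIANT — `Q′_k(U^u)R(u)λ = R(u_k)Q′_k(U)λ`, `u_k(y) = u(L^k·y)` THE GAUGE
# AT THE UNIT BLOCK's ORIGIN** — the `k`-level twin of `B9Eq333ProjectionCovariance.QprimeLin_gaugeU` ∕ `QprimeW_gaugeU`, through the lit-balaban
# cell's «\overline{U^u} = (Ū)^u» for the `k`-fold average (`B7AvgGaugeCovariance.avgIter_gaugeAct`) read on the torus tower `B9Eq315QTower.UlevOf`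

statement-level skeleton of published theorems with citation tags; proofs where landed; nothing here is a claim about the Yang–Mills mass gap

CITATION HEADER (lean-in-tree rule).  Audit cell `pub-balaban`, sub-cell `t4`, BINDER row NE9; filed by NE9 formalisation-swarm leaf prover 03
(`b2b-balaban-t4-ne9-formalise-leaf-03`, gen 64), brick (T2′) of the k-level Tier P programme (journal l.47756): the per-block gauge argument for the
`k`-level site operator (the twin of `B9Thm311SitePrimeFormCoerciveBlockGauge`) needs (3.32) for the COMPOSITE averaging, absent from the tree.  Source READ
in the held text: [Balaban1985BackgroundPropagators] pp. 393, 395–396 (`paper:balaban1985-cmp99-background-propagators`, journal page = PDF page + 388);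
[Balaban1985Averaging] pp. 19, 24 (quoted in `B7AvgGaugeCovariance`'s header).  Objects BY NAME: the owner's `towerP` ∕ `UlevOf` ∕ `QprimeTower` ∕
`QprimeTowerW` ∕ `perCfg_UlevOf` ∕ `smul_periodVec_towerP`, the lit-balaban cell's `avgIter_gaugeAct` ∕ `uLev` ∕ `gaugeAct` ∕ `perCfg_gaugeU'`, the chain's
`gaugeU` ∕ `AdW` ∕ `gaugeW`, and `B9Eq333ProjectionCovariance.QprimeLin_gaugeU`; nothing re-declared, 0 `def` (the level gauges are written as explicit
lambdas `x ↦ u(L^{k−j}·x̃ mod L^k m)`).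

THE PRINT (verbatim).  [B9] p. 395 (3.32): *«Q′(U^u)R(u)λ = R(u)Q′(U)λ»* (with «the gauge transformation u restricted to the lattice T^{(1)}»); p. 393 (3.19):
*«Q′_j(U) = Q′(Ū^{j−1}) … Q′(U)»*, (3.15): *«Ū^{j+1} = \overline{Ū^j}»*; p. 396: *«the equalities (3.32) hold again»*.  [B7] p. 19 (11): *«\overline{U^u}(y, y′) =
u(y)Ū(y, y′)u⁻¹(y′), or \overline{U^u} = (Ū)^u»*; p. 24: *«Let us notice also that the property (11) is satisfied»* (for (42)–(43), inside the domain of the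
logarithm).

WHAT IS PROVED (sorry-free; proof lane — 0 `def`; [folklore] torus ∕ `ℤ^d` bookkeeping on landed identities).
* §1 `perSite_smul_liftSite_perSite` (the level gauge is well defined on the torus: `L^{k−1−n}·(z mod L^{n+1}m) ≡ L^{k−1−n}·z mod L^k m`),
  `liftSite_centre` (`(L·y)~ = L·ỹ`), `gauge_level_compat` (`u_{j+1}(L·y) = u_j(y)` for `j < k`);
  **`UlevOf_gaugeU`** — «\overline{U^u}^{(i)} = (Ū^{(i)})^{u}» ON THE TORUS TOWER: under print's class (52) for the periodic extension (values in an
  averaging-closed subgroup `G` of the unit ball, `C₀α₀ ≤ ⅓`, `2α₀ ≤ c₂′`, `pdev Ũ < α₀L^{−2k}`) and a unit-bounded gauge `u`, for `n + 1 ≤ k`: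
  `UlevOf L m k (U^u) n = (UlevOf L m k U n)^{u_{n+1}}`, `u_{n+1}(x) = u(L^{k−1−n}·x̃ mod L^k m)` — `perCfg_UlevOf` + `perCfg_gaugeU'` + `avgIter_gaugeAct`.
* §2 `QprimeTower_gaugeU_of_compat` — ABSTRACT: for ANY level backgrounds `W_j` and level gauges `u_j` with `u_{j+1}(L·y) = u_j(y)` (`j < N`),
  `Q′_n(W^{u})(R(u_n)l) = R(u_0)·Q′_n(W)l` pointwise for `n ≤ N` (induction on the owner's `QprimeTower_succ` with `QprimeLin_gaugeU` at each factor);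
  **`QprimeTowerW_gaugeU`** — (3.32) FOR THE CHAIN's `Q′_{n+1}(U)`: `(Q′_{n+1}(U^u)R(u)λ)(y) = R(u(L^{n+1}·y))·(Q′_{n+1}(U)λ)(y)` under the class (52);
  **`norm_QprimeTowerW_gaugeU`** — `‖(Q′_{n+1}(U^u)R(u)λ)(y)‖ = ‖(Q′_{n+1}(U)λ)(y)‖` when `R(u(x))` is isometric on the fibre (unitary letters).
WHY (cell context).  The per-block gauge argument of the tower Tier P gauges ONE unit block by its axial gauge and reads `‖(Q′_k(U)λ)(y)‖` as
`‖(Q′_k(U^{u_y})h)(y)‖`, `h = R(u_y)λ` — this file — before comparing with the big block mean (`B9Eq319QprimeTowerBlockLocal`, this lineage) through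
the in-block level-bond smallness (`B7Eq47AveragedBondVsStraight` + the axial length count).
HONEST SCOPE.  [folklore] bookkeeping; the class (52) enters ONLY because the lit-balaban cell's covariance of the nonlinear average (42) is certified
inside the logarithm's domain (`Wcx_avgIter_lt_one`); nothing of [B9] ∕ [B7] asserted hypothesis-free.  NOT summit progress (cell pub-balaban: NE9 NOT
PRINTED ∕ NOT PROVED; «NE9 ⇐ the named binders»; spine PROVED 0/9; rung (B)+1 finite T⁴ — NOT infinite volume, NOT mass gap, NOT Clay; HONEST DEPENDENCY:
continuum YM on T⁴ ⇐ BetaPertH ∧ nine spine estimates (0/9 proved); BetaPertH ⇐ (D1) ∧ (D4) ∧ CAP+tail; G-an2-4 gates asym, D1 and NE2/3/4).  NEW file;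
nothing modified.  Net new unproved facts: 0.
-/

noncomputable section

open scoped BigOperators

namespace Literature.MathematicalPhysics.QuantumFieldTheory.Balaban1983to89.B9Eq332QprimeTowerGaugeCovariance

open B4Sect5Torus (TSite)
open B9SectCLatticeCarrier (Bond shift bpos btgt)
open B7Prop1Explicit (U1 gaugeAct e)
open B7Prop2Explicit (pdev avgIter C0 c2' AvgClosed)
open B7AvgGaugeCovariance (uLev uLev_apply avgIter_gaugeAct)
open B9Eq315QTorus (perSite perCfg perCfg_apply)
open B9Eq315QTorusOnto (liftSite periodVec perSite_liftSite liftSite_perSite_add perSite_add_periodVec)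
open B9Eq315QTower (towerP towerP_zero UlevOf QprimeTower QprimeTower_zero QprimeTower_succ perCfg_UlevOf smul_periodVec_towerP periodVec_neg)
open B9Eq319QprimeTorus (fineP centre centre_apply_val QprimeLin)
open B9Eq326OperatorTower (QprimeTowerW)
open B9Eq328GaugeAction (gaugeU gaugeU_apply AdW gaugeW equiv_gaugeW_eq)
open B9Eq310HessianOperator (adTransportW)
open B9Eq333ProjectionCovariance (QprimeLin_gaugeU)
open B7Eq44TorusAxialGauge (perCfg_gaugeU')
open B9Eq311L2Pairing (WL2)
open B11Eq103H1Complex (SiteL2K)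

variable {d : ℕ} (L : ℕ) [NeZero L] (m : Fin d → ℕ) [∀ i, NeZero (m i)]

/-! ## §1 The level gauges and «\overline{U^u} = (Ū)^u» on the torus tower -/

section Level

variable {G : Type*} [Group G]

/-- **THE LEVEL GAUGE IS WELL DEFINED ON THE TORUS**: for `n + 1 ≤ k`, `L^{k−1−n}·(z mod L^{n+1}m)~ ≡ L^{k−1−n}·z (mod L^k m)` — `liftSite (perSite z) = z −
periodVec t` and `L^{k−1−n}·periodVec_{n+1} = periodVec_k` (the owner's `smul_periodVec_towerP`). [cite: Balaban1985Averaging, (1) p.17, (43) p.24] -/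
theorem perSite_smul_liftSite_perSite {k n : ℕ} (hn : n + 1 ≤ k) (z : B7Prop1Explicit.Site d) :
    perSite (towerP L m k) (((L : ℤ) ^ (k - 1 - n)) • liftSite (perSite (towerP L m (n + 1)) z)) =
      perSite (towerP L m k) (((L : ℤ) ^ (k - 1 - n)) • z) := by
  set t : B7Prop1Explicit.Site d := fun i => z i / ((towerP L m (n + 1) i : ℕ) : ℤ) with ht
  have h := liftSite_perSite_add (P := towerP L m (n + 1)) z
  have h' : liftSite (perSite (towerP L m (n + 1)) z) = z + periodVec (towerP L m (n + 1)) (-t) := by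
    rw [periodVec_neg, ← sub_eq_add_neg, ht]; exact eq_sub_of_add_eq h
  have hk : k - (k - 1 - n) = n + 1 := by omega
  rw [h', smul_add, ← hk, smul_periodVec_towerP L m (by omega : k - 1 - n ≤ k), perSite_add_periodVec]

omit [∀ i, NeZero (m i)] in
/-- `(L·y)~ = L·ỹ`: the block origin `centre L P y` lifts to `L` times the lift of `y` (no wrap: `L·y_i < L·P_i`). [cite: Balaban1985Averaging, (2) p.17] -/
theorem liftSite_centre (P : Fin d → ℕ) (y : TSite d P) : liftSite (centre L P y) = (L : ℤ) • liftSite y := by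
  funext i
  simp only [liftSite, centre_apply_val, Pi.smul_apply, smul_eq_mul]
  push_cast
  ring

omit [Group G] in
/-- **THE LEVEL GAUGES ARE COMPATIBLE**: with `u_j(x) := u(L^{k−j}·x̃ mod L^k m)` on `T_{L^j m}`, `u_{j+1}(L·y) = u_j(y)` for `j < k` («u restricted to the
lattice T^{(1)}», p. 395). [cite: Balaban1985BackgroundPropagators, (3.32) p.395; Balaban1985Averaging, (11) p.19] -/
theorem gauge_level_compat {k j : ℕ} (hj : j < k) (g : TSite d (towerP L m k) → G) (y : TSite d (towerP L m j)) :
    g (perSite (towerP L m k) (((L : ℤ) ^ (k - (j + 1))) • liftSite (centre L (towerP L m j) y))) =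
      g (perSite (towerP L m k) (((L : ℤ) ^ (k - j)) • liftSite y)) := by
  rw [liftSite_centre, smul_smul, ← pow_succ, show k - (j + 1) + 1 = k - j by omega]

variable {𝔸 : Type*} [NormedRing 𝔸] [NormOneClass 𝔸] [NormedAlgebra ℂ 𝔸] [CompleteSpace 𝔸] (hL : 2 ≤ L) {S : Subgroup 𝔸ˣ}
  (hS : AvgClosed d L S) (k : ℕ) (U : Bond d (towerP L m k) → 𝔸ˣ) (hU : ∀ b, U b ∈ S) (g : TSite d (towerP L m k) → 𝔸ˣ) (hg : ∀ x, g x ∈ U1 𝔸)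
  {α₀ : ℝ} (hα : 0 < α₀) (hα3 : C0 d * α₀ ≤ 1 / 3) (hα2 : 2 * α₀ ≤ c2' d L)
  (h52 : pdev (perCfg (towerP L m k) U) < α₀ * (((L : ℝ) ^ k)⁻¹) ^ 2)

include hL hS hU hg hα hα3 hα2 h52 in
/-- **«\overline{U^u}^{(i)} = (Ū^{(i)})^{u}» ON THE TORUS TOWER**: for `n + 1 ≤ k`, the level-`(n+1)` background of the gauged field is the gauged
level background, `UlevOf L m k (U^u) n = (UlevOf L m k U n)^{u_{n+1}}` with the level gauge `u_{n+1}(x) = u(L^{k−1−n}·x̃ mod L^k m)` — the lit-balaban cell's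
`avgIter_gaugeAct` (inside the logarithm's domain under (52)) read through the owner's `perCfg_UlevOf` and `perCfg_gaugeU'`.
[cite: Balaban1985Averaging, (11) p.19, p.24, (43) p.24; Balaban1985BackgroundPropagators, (3.15) p.393, (3.32) p.395] -/
theorem UlevOf_gaugeU (n : ℕ) (hn : n + 1 ≤ k) :
    UlevOf L m k (gaugeU g U) n =
      gaugeU (fun x : TSite d (towerP L m (n + 1)) => g (perSite (towerP L m k) (((L : ℤ) ^ (k - 1 - n)) • liftSite x))) (UlevOf L m k U n) := by
  -- compare the periodic extensions
  have hV : ∀ (x : B7Prop1Explicit.Site d) (κ : Fin d), perCfg (towerP L m k) U x κ ∈ S := fun x κ => by rw [perCfg_apply]; exact hU _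
  have hu : ∀ x : B7Prop1Explicit.Site d, (fun z => g (perSite (towerP L m k) z)) x ∈ U1 𝔸 := fun x => hg _
  have hi : k - 1 - n ≤ k := by omega
  have hper : perCfg (towerP L m (n + 1)) (UlevOf L m k (gaugeU g U) n) =
      perCfg (towerP L m (n + 1)) (gaugeU (fun x : TSite d (towerP L m (n + 1)) =>
        g (perSite (towerP L m k) (((L : ℤ) ^ (k - 1 - n)) • liftSite x))) (UlevOf L m k U n)) := by
    rw [perCfg_UlevOf L m hn, perCfg_gaugeU', perCfg_gaugeU', perCfg_UlevOf L m hn,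
      avgIter_gaugeAct L hL hS k _ hV hu hα hα3 hα2 h52 (k - 1 - n) hi]
    congr 1
    funext z
    rw [uLev_apply, perSite_smul_liftSite_perSite L m hn]
  funext b
  have key := congrFun (congrFun hper (liftSite b.1)) b.2
  simpa only [perCfg_apply, perSite_liftSite] using key

end Level

/-! ## §2 (3.32) for the composite `Q′_k` -/

section Qprime

variable {𝔸 : Type*} [Ring 𝔸] [Algebra ℂ 𝔸] {W : Type*} [NormedAddCommGroup W] [InnerProductSpace ℂ W] (φ : W ≃ₗ[ℂ] 𝔸)

omit [∀ i, NeZero (m i)] in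
/-- `Q′_n` reads the level data only below `n`: families agreeing on `j < n` give the same `Q′_n`. [cite: Balaban1985BackgroundPropagators, (3.19) p.393] -/
theorem QprimeTower_congr {V : Type*} [AddCommGroup V] [Module ℂ V] (R R' : (j : ℕ) → Bond d (towerP L m (j + 1)) → V →ₗ[ℂ] V) :
    ∀ n : ℕ, (∀ j < n, R j = R' j) → QprimeTower L m R n = QprimeTower L m R' n
  | 0, _ => rfl
  | n + 1, h => by
    rw [QprimeTower_succ, QprimeTower_succ, QprimeTower_congr R R' n (fun j hj => h j (Nat.lt_succ_of_lt hj)), h n (Nat.lt_succ_self n)]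

omit [∀ i, NeZero (m i)] in
/-- **(3.32) FOR THE COMPOSITE, ABSTRACT IN THE LEVEL DATA**: for level backgrounds `W_j` on the bonds of `T_{L^{j+1}m}` and level gauges `u_j` on
`T_{L^j m}` with `u_{j+1}(L·y) = u_j(y)` for `j < N`, and every `n ≤ N`: `Q′_n((W^{u})) (x ↦ R(u_n(x))l(x)) (y) = R(u_0(y))·(Q′_n(W)l)(y)` — induction on
`QprimeTower_succ`, `QprimeLin_gaugeU` at each factor. [cite: Balaban1985BackgroundPropagators, (3.32) p.395, (3.19) p.393, p.396] -/
theorem QprimeTower_gaugeU_of_compat (Wlev : (j : ℕ) → Bond d (towerP L m (j + 1)) → 𝔸ˣ) (gl : (j : ℕ) → TSite d (towerP L m j) → 𝔸ˣ) (N : ℕ)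
    (hcompat : ∀ j < N, ∀ y : TSite d (towerP L m j), gl (j + 1) (centre L (towerP L m j) y) = gl j y) :
    ∀ n ≤ N, ∀ (l : TSite d (towerP L m n) → W) (y : TSite d m),
      QprimeTower L m (fun j => adTransportW φ (gaugeU (gl (j + 1)) (Wlev j))) n (fun x => AdW φ (gl n x) (l x)) y =
        AdW φ (gl 0 y) (QprimeTower L m (fun j => adTransportW φ (Wlev j)) n l y)
  | 0, _, l, y => rfl
  | n + 1, hn, l, y => by
    have hlt : n < N := Nat.lt_of_succ_le hn
    have e1 : QprimeTower L m (fun j => adTransportW φ (gaugeU (gl (j + 1)) (Wlev j))) (n + 1) (fun x => AdW φ (gl (n + 1) x) (l x)) y =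
        QprimeTower L m (fun j => adTransportW φ (gaugeU (gl (j + 1)) (Wlev j))) n
          (QprimeLin L (towerP L m n) (adTransportW φ (gaugeU (gl (n + 1)) (Wlev n))) (fun x => AdW φ (gl (n + 1) x) (l x))) y := rfl
    have e2 : QprimeTower L m (fun j => adTransportW φ (Wlev j)) (n + 1) l y =
        QprimeTower L m (fun j => adTransportW φ (Wlev j)) n (QprimeLin L (towerP L m n) (adTransportW φ (Wlev n)) l) y := rfl
    have hstep : QprimeLin L (towerP L m n) (adTransportW φ (gaugeU (gl (n + 1)) (Wlev n))) (fun x => AdW φ (gl (n + 1) x) (l x)) =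
        fun y' => AdW φ (gl n y') (QprimeLin L (towerP L m n) (adTransportW φ (Wlev n)) l y') := by
      funext y'
      rw [QprimeLin_gaugeU, hcompat n hlt y']
    rw [e1, e2, hstep]
    exact QprimeTower_gaugeU_of_compat Wlev gl N hcompat n (Nat.le_of_succ_le hn) _ y


end Qprime

section Chain

variable {𝔸 : Type*} [NormedRing 𝔸] [NormOneClass 𝔸] [NormedAlgebra ℂ 𝔸] [CompleteSpace 𝔸] (hL : 2 ≤ L) {S : Subgroup 𝔸ˣ}
  (hS : AvgClosed d L S) (n : ℕ) (U : Bond d (towerP L m (n + 1)) → 𝔸ˣ) (hU : ∀ b, U b ∈ S) (g : TSite d (towerP L m (n + 1)) → 𝔸ˣ)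
  (hg : ∀ x, g x ∈ U1 𝔸) {α₀ : ℝ} (hα : 0 < α₀) (hα3 : C0 d * α₀ ≤ 1 / 3) (hα2 : 2 * α₀ ≤ c2' d L)
  (h52 : pdev (perCfg (towerP L m (n + 1)) U) < α₀ * (((L : ℝ) ^ (n + 1))⁻¹) ^ 2)
  {W : Type*} [NormedAddCommGroup W] [InnerProductSpace ℂ W] (φ : W ≃ₗ[ℂ] 𝔸) {c₀ : ℝ}

include hL hS hU hg hα hα3 hα2 h52 in
/-- **(3.32) FOR THE CHAIN's COMPOSITE `Q′_{n+1}(U)`** under print's class (52) for the periodic extension and a unit-bounded gauge `u`: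
`(Q′_{n+1}(U^u)R(u)λ)(y) = R(u(L^{n+1}·ỹ mod L^{n+1}m))·(Q′_{n+1}(U)λ)(y)` — the gauge at the unit block's ORIGIN. [cite: Balaban1985BackgroundPropagators, (3.32) p.395, (3.19) p.393, p.396; Balaban1985Averaging, (11) p.19] -/
theorem QprimeTowerW_gaugeU (lam : SiteL2K ℂ d (towerP L m (n + 1)) c₀ W) (y : TSite d m) :
    QprimeTowerW L m n φ (gaugeU g U) (c₀ := c₀) (gaugeW φ g lam) y =
      AdW φ (g (perSite (towerP L m (n + 1)) (((L : ℤ) ^ (n + 1)) • liftSite y))) (QprimeTowerW L m n φ U (c₀ := c₀) lam y) := by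
  -- the level gauges `u_j(x) = u(L^{k−j}·x̃)`, `k = n+1`
  set gl : (j : ℕ) → TSite d (towerP L m j) → 𝔸ˣ :=
    fun j x => g (perSite (towerP L m (n + 1)) (((L : ℤ) ^ (n + 1 - j)) • liftSite x)) with hgl
  have hcompat : ∀ j < n + 1, ∀ y' : TSite d (towerP L m j), gl (j + 1) (centre L (towerP L m j) y') = gl j y' :=
    fun j hj y' => gauge_level_compat L m hj g y'
  -- the level backgrounds of `U^u` read by `Q′_{n+1}` are the gauged level backgrounds
  have hR : ∀ j < n + 1, adTransportW φ (UlevOf L m (n + 1) (gaugeU g U) j) = adTransportW φ (gaugeU (gl (j + 1)) (UlevOf L m (n + 1) U j)) := by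
    intro j hj
    rw [UlevOf_gaugeU L m hL hS (n + 1) U hU g hg hα hα3 hα2 h52 j (by omega)]
    have e : n + 1 - 1 - j = n + 1 - (j + 1) := by omega
    rw [e]
  -- the finest gauge is `u` itself
  have hl : (WL2.linearEquiv ℂ ℂ (fun _ : TSite d (towerP L m (n + 1)) => c₀) (gaugeW φ g lam) : TSite d (towerP L m (n + 1)) → W) =
      fun x => AdW φ (gl (n + 1) x) (WL2.linearEquiv ℂ ℂ (fun _ : TSite d (towerP L m (n + 1)) => c₀) lam x) := by
    funext x
    rw [WL2.linearEquiv_apply, WL2.linearEquiv_apply, equiv_gaugeW_eq, hgl]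
    simp only [Nat.sub_self, pow_zero, one_smul, perSite_liftSite]
  unfold QprimeTowerW
  rw [LinearMap.comp_apply, LinearMap.comp_apply, QprimeTower_congr L m _ _ (n + 1) hR]
  erw [hl]
  rw [QprimeTower_gaugeU_of_compat L m φ (UlevOf L m (n + 1) U) gl (n + 1) hcompat (n + 1) le_rfl]
  simp only [hgl, Nat.sub_zero]
  rfl

omit [NormOneClass 𝔸] [CompleteSpace 𝔸] [∀ i, NeZero (m i)] [NeZero L] in
/-- `R(u)` isometric on the fibre ⇒ `‖R(u)v‖ = ‖v‖`. [folklore] [cite: Balaban1985BackgroundPropagators, (3.32) p.395, (3.5) p.391] -/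
private theorem norm_AdW_of_inner' {u : 𝔸ˣ} (hu : ∀ v v' : W, inner ℂ (AdW φ u v) (AdW φ u v') = inner ℂ v v') (v : W) : ‖AdW φ u v‖ = ‖v‖ := by
  rw [@norm_eq_sqrt_re_inner ℂ, hu, ← @norm_eq_sqrt_re_inner ℂ]

include hL hS hU hg hα hα3 hα2 h52 in
/-- **`‖(Q′_{n+1}(U^u)R(u)λ)(y)‖ = ‖(Q′_{n+1}(U)λ)(y)‖` FOR ISOMETRIC `R(u(x))`** (unitary gauge letters) — the form the per-block gauge argument consumes:
the block is gauged, the norm of the composite average is unchanged. [cite: Balaban1985BackgroundPropagators, (3.32) p.395, p.396] -/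
theorem norm_QprimeTowerW_gaugeU (hAd : ∀ (x : TSite d (towerP L m (n + 1))) (v v' : W), inner ℂ (AdW φ (g x) v) (AdW φ (g x) v') = inner ℂ v v')
    (lam : SiteL2K ℂ d (towerP L m (n + 1)) c₀ W) (y : TSite d m) :
    ‖QprimeTowerW L m n φ (gaugeU g U) (c₀ := c₀) (gaugeW φ g lam) y‖ = ‖QprimeTowerW L m n φ U (c₀ := c₀) lam y‖ := by
  rw [QprimeTowerW_gaugeU L m hL hS n U hU g hg hα hα3 hα2 h52 φ lam y, norm_AdW_of_inner' φ (hAd _)]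

end Chain

end Literature.MathematicalPhysics.QuantumFieldTheory.Balaban1983to89.B9Eq332QprimeTowerGaugeCovariance

end
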